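import Summits.Langlands.Langlands.Statement
import Literature.NumberTheory.EllipticCurves.FramedTateGaloisRep
import Literature.NumberTheory.Automorphic.CaraianiNewtonResidualImageModularity
import Literature.NumberTheory.Automorphic.ReciprocityGLnPotentialModularityTateProofs
import Literature.NumberTheory.Automorphic.GLnAdelicStructureProofs
import HarnessLib

/-!
# `Lines/QuarticCMEllipticGaloisToAutomorphic_onpath` — F4 on-path theorem `Langlands → rung` (generation 15).  Sorry-free.

`ellipticGaloisToAutomorphicCM_of_langlands (d) : Langlands → EllipticGaloisToAutomorphicCM d` (take `Rec` from
`Langlands K`; `Rec.pst = fontainePstAdicCompletion` is `rfl`; clause (B) at `n = 2` ⇒ `Corresponds` ⇒ a.e. Satake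
match, shift `m = 1`) and `@[aesop safe apply] QuarticCMEllipticGaloisToAutomorphic_of_Langlands` (the tribunal
kernel's `s_implies_c` closes by `intro h; aesop`).
-/

noncomputable section

set_option linter.dupNamespace false

open scoped MatrixGroups Matrix NumberField Classical Polynomial
open Filter IsDedekindDomain Field Polynomial WeierstrassCurve
open Literature.NumberTheory.Automorphic Literature.NumberTheory.GaloisRepresentations
open Literature.NumberTheory.EllipticCurves
open Literature.NumberTheory.PAdicHodge
open Summit.Langlands

namespace Summit.Langlands.Langlands.Cruxes.ReciprocityUpToIrreducibility.QuarticCMEllipticGaloisToAutomorphic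

/-- **The RUNG FAMILY, dial = degree `d` of the imaginary CM base field** (clause (B) of the summit at
`n = 2` on the Caraiani–Newton sector, Galois-side and archimedean-free exactly as the summit's
`Corresponds`): for every number field `K` which is CM (`NumberField.IsCMField`: a totally complex quadratic
extension of its maximal totally real subfield) of degree `d` in which every fifth root of unity is trivial,
every elliptic curve `E / K` WITHOUT complex multiplication whose mod-`3` representation is absolutely
irreducible over `K(ζ₃)` OR whose mod-`5` representation is absolutely irreducible over `K(ζ₅)`
(`ModPImageAbsIrreducibleOverCyclotomic`, every framing, every model), every prime `ℓ` and `ι : ℚ̄_ℓ ≃+* ℂ`: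
if the framed dual Tate module `ρ := ρ_{E,ℓ}^∨ : Γ_K → GL₂(ℚ̄_ℓ)` is irreducible and de Rham at the places
above `ℓ` (for the pinned Fontaine datum), then there are a cuspidal automorphic representation `π` of
`GL₂(𝔸_K)` and a shift `m : ℕ` such that at all but finitely many finite places `v`, `π_v` is unramified
with Satake parameter `α`, `ρ` is unramified at `v`, and every arithmetic Frobenius at `v` has characteristic
polynomial `∏_{a ∈ α} (X - ι⁻¹((q_v^{(m-1)/2} a)⁻¹))` on `ρ` (`arithFrobPolyOfSatake ι q_v m α`). -/
def EllipticGaloisToAutomorphicCM (d : ℕ) : Prop :=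
  ∀ (K : Type) [Field K] [NumberField K], NumberField.IsCMField K → Module.finrank ℚ K = d →
    (∀ x : K, x ^ 5 = 1 → x = 1) →
    ∀ (E : WeierstrassCurve K) [E.IsElliptic], ¬ E.HasCM →
      (ModPImageAbsIrreducibleOverCyclotomic E 3 ∨
        @ModPImageAbsIrreducibleOverCyclotomic K _ E 5 ⟨Nat.prime_five⟩) →
      ∀ (ℓ : ℕ) [Fact ℓ.Prime] (ι : PadicAlgCl ℓ ≃+* ℂ),
        (E.framedTateGaloisRepDual ℓ).toGaloisRep.IsIrreducible →
        (∀ (v : HeightOneSpectrum (𝓞 K)) (hv : ((ℓ : ℕ) : 𝓞 K) ∈ v.asIdeal),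
            (fontainePstAdicCompletion v ℓ hv).IsDeRhamFramed ((E.framedTateGaloisRepDual ℓ).toLocal v)) →
        ∃ (hK : isCompact_glFiniteIntegralLevel 2 K) (π : CuspidalAutomorphicRepData 2 K hK) (m : ℕ),
          ∀ᶠ v : HeightOneSpectrum (𝓞 K) in Filter.cofinite, ∃ α : Multiset ℂ,
            π.1.HasSatakeParamAt v α ∧
            (E.framedTateGaloisRepDual ℓ).IsUnramifiedAt v ∧
            (E.framedTateGaloisRepDual ℓ).HasFrobCharpolyAt v (arithFrobPolyOfSatake ι v.residueCard m α)

/-- **THE RUNG** (the filed statement): the family at `d = 4` — clause (B) for the Tate modules of non-CM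
elliptic curves with residually large image over imaginary CM QUARTIC fields `K ≠ ℚ(ζ₅)`. -/
def QuarticCMEllipticGaloisToAutomorphic : Prop := EllipticGaloisToAutomorphicCM 4

/-! ### On-path: the summit gives every rung of the family -/

/-- **Dial monotonicity in the summit direction**: the summit gives every rung of the family
(restriction of clause (B) at `n = 2` to `ρ_{E,ℓ}^∨`, shift `m = 1`). -/
theorem ellipticGaloisToAutomorphicCM_of_langlands (d : ℕ) (hL : _root_.Langlands) :
    EllipticGaloisToAutomorphicCM d := by
  intro K _ _ _hCM _hd _h5 E _ _hnCM _himg ℓ _ ι hirr hdR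
  obtain ⟨⟨Rec⟩, hall⟩ := hL K
  have hcpt : isCompact_glFiniteIntegralLevel 2 K := isCompact_glFiniteIntegralLevel_holds 2 K
  have hB : GaloisToAutomorphic 2 Rec hcpt := (hall Rec 2 two_pos hcpt).2
  have hgeo : IsGeometricFramed Rec (E.framedTateGaloisRepDual ℓ) :=
    ⟨E.eventually_isUnramifiedAt_framedTateGaloisRepDual ℓ, fun v hv => hdR v hv⟩
  obtain ⟨π, -, hcorr⟩ := hB ℓ ι _ hirr hgeo
  refine ⟨hcpt, π, 1, ?_⟩
  filter_upwards [hcorr.1] with v hv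
  exact hv

/-- **F4 on-path lemma for the rung**: `Langlands → QuarticCMEllipticGaloisToAutomorphic`. -/
@[aesop safe apply]
theorem QuarticCMEllipticGaloisToAutomorphic_of_Langlands (hL : _root_.Langlands) :
    QuarticCMEllipticGaloisToAutomorphic :=
  ellipticGaloisToAutomorphicCM_of_langlands 4 hL

end Summit.Langlands.Langlands.Cruxes.ReciprocityUpToIrreducibility.QuarticCMEllipticGaloisToAutomorphic

end
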